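import Mathlib
import HarnessLib
import Summits.NavierStokesRegularity.NavierStokesRegularity.Theorems.StableStrataDoorAcrossSolutions
import Summits.NavierStokesRegularity.NavierStokesRegularity.Theorems.StableStrataDoorInstances
import Summits.NavierStokesRegularity.NavierStokesRegularity.Theorems.StableStrataDoorOneSliceAxiSeq
import Summits.NavierStokesRegularity.NavierStokesRegularity.Theorems.SineMomentDoorSeq

/-!
# OneTimeDoors — the S26-schema doors in the CLASS-UNIFORM ONE-TIME (Pineau–Vicol) shape, UNCONDITIONAL

With I1⋆ in the tree (`StableStrataDoorAcrossSolutions.localPointZoomAcrossSolutionsM_holds`), nsreg-p1 g23's §5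
`OneTimeDoorSchema.uniformOneTimeDoorAt_of_liouville` turns every instance of the S26 schema (observable `Φ` with (H1) window lsc,
(H2) analytic spread, one-slice stratum Liouville theorem) into the class-uniform ONE-TIME door `UniformOneTimeDoorAt Φ ν M`:
some `ε = ε(ν, M, Φ) > 0` and, for every class `(T, ρ, E₀)`, ONE lateness threshold `t⋆ < T` such that `Φ ≤ ε` at ONE time
`t̄ ∈ (t⋆, T)` on the scale-normalised window field excludes the singularity (ε and `t⋆` by compactness — nothing explicit).
This file (name per nsreg-p1 g23) records the three instances the tree holds: the QUIET stratum (`quietPhi`), the AXISYMMETRIC stratum (`axiPhi`, door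
S26/T-axi) and the UNIDIRECTIONAL-VORTICITY stratum of door S27 «SineMomentDoor» (`sinePhi`).  One-liners; theorems only.
Door family of LADDER-NS N0 (`--supports stmt-NavierStokesRegularity-0056`; nsreg-p6 g15, DIRECTOR-NS #100 (2) payoff).
WHAT THIS IS NOT: not NS regularity (Clay A) — ε-criteria INSIDE the Type-I class in the one-time quantifier shape; no route, no item.
-/

noncomputable section

set_option linter.dupNamespace false

namespace Summit.NavierStokesRegularity.NavierStokesRegularity.Theorems.OneTimeDoors

open Set Metric
open Summit.NavierStokesRegularity.NavierStokesRegularity.Theorems.StableStrataDoorInstances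
open Summit.NavierStokesRegularity.NavierStokesRegularity.Theorems.StableStrataDoorOneSliceAxiSeq
open Summit.NavierStokesRegularity.NavierStokesRegularity.Theorems.OneTimeDoorSchema
open Summit.NavierStokesRegularity.NavierStokesRegularity.Theorems.StableStrataDoorAcrossSolutions
open Summit.NavierStokesRegularity.NavierStokesRegularity.Theorems.SineMomentDoor

/-- **The class-uniform one-time QUIET door** (null stratum; cf. T-quiet / T-quiet-seq). -/
theorem uniformOneTimeDoorAt_quiet {ν M : ℝ} (hν : 0 < ν) {U : Set (EuclideanSpace ℝ (Fin 3))} (hU : IsOpen U)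
    (hne : U.Nonempty) : UniformOneTimeDoorAt (quietPhi U) ν M :=
  uniformOneTimeDoorAt_of_liouville hν localPointZoomAcrossSolutionsM_holds (isWindowLsc_quietPhi U)
    (spreadsTo_quietPhi hν hU hne) fun D _ => oneSliceLiouville_quiet D

/-- **The class-uniform one-time AXISYMMETRIC door** (stratum of door S26 / T-axi-seq, axis `A e₃`). -/
theorem uniformOneTimeDoorAt_axi {ν M : ℝ} (hν : 0 < ν) (A : EuclideanSpace ℝ (Fin 3) ≃ₗᵢ[ℝ] EuclideanSpace ℝ (Fin 3))
    {U : Set (EuclideanSpace ℝ (Fin 3))} (hU : IsOpen U) (hne : U.Nonempty) : UniformOneTimeDoorAt (axiPhi A U) ν M :=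
  uniformOneTimeDoorAt_of_liouville hν localPointZoomAcrossSolutionsM_holds (isWindowLsc_axiPhi A U)
    (spreadsTo_axiPhi hν A hU hne) fun D _ => oneSliceLiouville_axi A D

/-- **The class-uniform one-time SINE-MOMENT door** (unidirectional-vorticity stratum of door S27 «SineMomentDoor», cap `B`). -/
theorem uniformOneTimeDoorAt_sine {ν M : ℝ} (hν : 0 < ν) {U : Set (EuclideanSpace ℝ (Fin 3))} (hU : IsOpen U)
    (hne : U.Nonempty) {B : ℝ} (hB : 0 < B) : UniformOneTimeDoorAt (sinePhi U B) ν M :=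
  uniformOneTimeDoorAt_of_liouville hν localPointZoomAcrossSolutionsM_holds (isWindowLsc_sinePhi U hB)
    (spreadsTo_sinePhi hν hU hne hB) fun D _ => oneSliceLiouville_uni D

/-- Sanity: the class-uniform one-time doors imply the sequential doors of record (`OneTimeDoorSchema.seqDoorAt_of_uniform`);
here for the three instances at once. -/
theorem seqDoorAt_of_uniform_instances {ν M : ℝ} (hν : 0 < ν) {U : Set (EuclideanSpace ℝ (Fin 3))} (hU : IsOpen U)
    (hne : U.Nonempty) (A : EuclideanSpace ℝ (Fin 3) ≃ₗᵢ[ℝ] EuclideanSpace ℝ (Fin 3)) {B : ℝ} (hB : 0 < B) :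
    StableStrataDoorOneSliceSeqDoor.SeqDoorAt (quietPhi U) ν M ∧
      StableStrataDoorOneSliceSeqDoor.SeqDoorAt (axiPhi A U) ν M ∧
        StableStrataDoorOneSliceSeqDoor.SeqDoorAt (sinePhi U B) ν M :=
  ⟨seqDoorAt_of_uniform (uniformOneTimeDoorAt_quiet hν hU hne),
    seqDoorAt_of_uniform (uniformOneTimeDoorAt_axi hν A hU hne),
    seqDoorAt_of_uniform (uniformOneTimeDoorAt_sine hν hU hne hB)⟩

end Summit.NavierStokesRegularity.NavierStokesRegularity.Theorems.OneTimeDoors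

end
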